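import Summits.CriticalPhenomena.CardyFormulaZ2.Theorems.CardyBoundaryCoulombGasRectilinearCardyStubBetaRatioIdentity
import Summits.CriticalPhenomena.CardyFormulaZ2.Theorems.CardyBoundaryCoulombGasRectilinearCardyStubContinuumTail
import HarnessLib

/-!
# Stub `stub_kernelWindowLaw` of line `excursion-kernel-covariance`, part 4: the window increment of
# the continuum tail and the change of variables along a flat side
# (crux `RectilinearCardy`, stmt-CriticalPhenomena-5660, route `CardyBoundaryCoulombGas`)

Second real-analysis input of the kernel window law:

* `kwl_cardy_window_increment` — the integrated form of Cardy's ODE along the third point, read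
  through a strictly monotone-or-antitone boundary correspondence `g`:
  `F(η(g m₀, g m₁, g s, g m₃)) - F(η(g m₀, g m₁, g s', g m₃)) = κ |∫_{g s}^{g s'} |(y-x₀)(y-x₁)(y-x₃)|^{-2/3} dy|`
  with `κ = (cardyConst/3) |(x₁-x₀)(x₃-x₀)(x₃-x₁)|^{1/3}`, `xᵢ = g mᵢ` (two instances of the landed
  `cardyConst_mul_integral_eq_cardyFunction`; antitone data by the reflection `t ↦ -t`, `crossRatio_third_neg`);
* `kwl_side_integral` — change of variables along a straight side: for `w` holomorphic near the
  segment `x ↦ x e + c` (`|e| = 1`), real and injective on it,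
  `∫_α^β |w′(xe + c)| G(Re w(xe + c)) dx = |∫_{Re w(αe+c)}^{Re w(βe+c)} G|` (the derivative along the
  side is real, of constant sign since `w` is monotone there;
  `intervalIntegral.integral_comp_mul_deriv'`).

All [folklore] calculus; Cardy's ODE enters only through the landed calculus of
`stub_betaRatioIdentity`.
-/

noncomputable section

open Set Filter Topology MeasureTheory Metric

namespace Summit.CriticalPhenomena.CardyFormulaZ2.Cruxes.RectilinearCardy.ExcursionKernelCovariance

open Literature.Probability.RandomPlanarGeometry

/-! ### The window increment of the continuum tail -/

/-- The weight `ω(t) = |(t-a)(t-b)(t-d)|^{-2/3}` is continuous away from `a`, `b`, `d`. [folklore] -/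
theorem kwl_continuousOn_omega {a b d : ℝ} {s : Set ℝ} (hs : ∀ t ∈ s, t ≠ a ∧ t ≠ b ∧ t ≠ d) :
    ContinuousOn (fun t : ℝ => |(t - a) * (t - b) * (t - d)| ^ (-(2 / 3 : ℝ))) s := by
  refine ContinuousOn.rpow_const (by fun_prop) fun t ht => Or.inl ?_
  obtain ⟨h1, h2, h3⟩ := hs t ht
  exact abs_ne_zero.2 (mul_ne_zero (mul_ne_zero (sub_ne_zero.2 h1) (sub_ne_zero.2 h2))
    (sub_ne_zero.2 h3))

/-- The weight `ω` is interval integrable up to the pole `d`: for `a < b < d` and `y ∈ [b, d]`,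
`ω` is integrable on `[y, d]` (it is, up to a positive constant, the derivative of the continuous
monotone function `-F(η(b, a, d, ·))` — `intervalIntegral.integrableOn_deriv_of_nonneg`, as in the
landed `cardyConst_mul_integral_eq_cardyFunction`). [folklore] -/
theorem kwl_intervalIntegrable_omega_tail {a b d y : ℝ} (hab : a < b) (hbd : b < d)
    (hy : y ∈ Icc b d) :
    IntervalIntegrable (fun t : ℝ => |(t - a) * (t - b) * (t - d)| ^ (-(2 / 3 : ℝ))) volume y d := by
  -- adapted from `cardyConst_mul_integral_eq_cardyFunction` (StubBetaRatioIdentity)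
  set c : ℝ := cardyConst / 3 * ((b - a) * (d - a) * (d - b)) ^ (1 / 3 : ℝ) with hc
  have hc0 : 0 < c := by
    have h1 : 0 < b - a := sub_pos.2 hab
    have h2 : 0 < d - a := sub_pos.2 (hab.trans hbd)
    have h3 : 0 < d - b := sub_pos.2 hbd
    have := cardyConst_pos
    positivity
  have hGc : ContinuousOn (fun t : ℝ ↦ -cardyFunction (crossRatio ![b, a, d, t])) (Icc y d) :=
    ((continuousOn_cardyFunction_crossRatio_third hab hbd).mono (Icc_subset_Icc_left hy.1)).neg
  have hGd : ∀ t ∈ Ioo y d, HasDerivAt (fun t : ℝ ↦ -cardyFunction (crossRatio ![b, a, d, t]))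
      (c * |(t - a) * (t - b) * (t - d)| ^ (-(2 / 3 : ℝ))) t := fun t ht ↦ by
    simpa only [neg_neg] using
      (hasDerivAt_cardyFunction_crossRatio_third hab (hy.1.trans_lt ht.1) ht.2).fun_neg
  have hint := intervalIntegral.integrableOn_deriv_of_nonneg hGc hGd fun t _ ↦
    mul_nonneg hc0.le (Real.rpow_nonneg (abs_nonneg _) _)
  have h1 : IntervalIntegrable (fun t : ℝ => c * |(t - a) * (t - b) * (t - d)| ^ (-(2 / 3 : ℝ)))
      volume y d :=
    (intervalIntegrable_iff_integrableOn_Ioc_of_le hy.2).2 hint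
  have h2 := h1.const_mul c⁻¹
  have heq : (fun t : ℝ => c⁻¹ * (c * |(t - a) * (t - b) * (t - d)| ^ (-(2 / 3 : ℝ)))) =
      fun t : ℝ => |(t - a) * (t - b) * (t - d)| ^ (-(2 / 3 : ℝ)) :=
    funext fun t => inv_mul_cancel_left₀ hc0.ne' _
  rwa [heq] at h2

/-- **The increment of `y ↦ F(η(a, b, y, d))` for `a < b < y ≤ y' < d`** is
`(cardyConst/3)((b-a)(d-a)(d-b))^{1/3} ∫_y^{y'} ω` (difference of two instances of the landed
integrated ODE `cardyConst_mul_integral_eq_cardyFunction`). [folklore] -/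
theorem kwl_cardy_sub_of_lt {a b d y y' : ℝ} (hab : a < b) (hby : b < y) (hyy' : y ≤ y')
    (hy'd : y' < d) :
    cardyFunction (crossRatio ![a, b, y, d]) - cardyFunction (crossRatio ![a, b, y', d]) =
      cardyConst / 3 * ((b - a) * (d - a) * (d - b)) ^ (1 / 3 : ℝ) *
        ∫ t in y..y', |(t - a) * (t - b) * (t - d)| ^ (-(2 / 3 : ℝ)) := by
  have hbd : b < d := hby.trans (hyy'.trans_lt hy'd)
  have hyI : y ∈ Icc b d := ⟨hby.le, hyy'.trans hy'd.le⟩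
  have hy'I : y' ∈ Icc b d := ⟨hby.le.trans hyy', hy'd.le⟩
  have hcont : IntervalIntegrable (fun t : ℝ => |(t - a) * (t - b) * (t - d)| ^ (-(2 / 3 : ℝ)))
      volume y y' := by
    refine ContinuousOn.intervalIntegrable_of_Icc hyy' (kwl_continuousOn_omega fun t ht => ?_)
    exact ⟨(hab.trans (hby.trans_le ht.1)).ne', (hby.trans_le ht.1).ne', (ht.2.trans_lt hy'd).ne⟩
  rw [← crossRatio_swap_pairs a b d y, ← crossRatio_swap_pairs a b d y',
    ← cardyConst_mul_integral_eq_cardyFunction hab hbd hyI,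
    ← cardyConst_mul_integral_eq_cardyFunction hab hbd hy'I, ← mul_sub,
    ← intervalIntegral.integral_add_adjacent_intervals hcont
      (kwl_intervalIntegrable_omega_tail hab hbd hy'I)]
  ring

/-- The reflection `t ↦ -t` on the window integral of `ω`. [folklore] -/
theorem kwl_integral_omega_neg (a b d y y' : ℝ) :
    ∫ t in -y..-y', |(t - -a) * (t - -b) * (t - -d)| ^ (-(2 / 3 : ℝ)) =
      -∫ t in y..y', |(t - a) * (t - b) * (t - d)| ^ (-(2 / 3 : ℝ)) := by
  -- adapted from `integral_betaWeight_neg` (StubBetaRatioIdentity)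
  have h := intervalIntegral.integral_comp_neg (a := -y) (b := -y')
    (f := fun s : ℝ ↦ |(s - a) * (s - b) * (s - d)| ^ (-(2 / 3 : ℝ)))
  simp only [neg_neg] at h
  rw [← intervalIntegral.integral_symm, ← h]
  congr 1
  funext t
  rw [show (-t - a) * (-t - b) * (-t - d) = -((t - -a) * (t - -b) * (t - -d)) by ring, abs_neg]

/-- **The window increment of the continuum tail.** For `g` strictly monotone or strictly antitone on
a set containing `m₀ < m₁ < s ≤ s' < m₃`, with `xᵢ = g mᵢ`:
`F(η(x₀, x₁, g s, x₃)) - F(η(x₀, x₁, g s', x₃)) = (cardyConst/3) |(x₁-x₀)(x₃-x₀)(x₃-x₁)|^{1/3} ·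
|∫_{g s}^{g s'} |(y-x₀)(y-x₁)(y-x₃)|^{-2/3} dy|` (monotone data: `kwl_cardy_sub_of_lt`; antitone
data reduce to monotone ones by `t ↦ -t`). [folklore] -/
theorem kwl_cardy_window_increment {g : ℝ → ℝ} {I : Set ℝ}
    (hg : StrictMonoOn g I ∨ StrictAntiOn g I) {m₀ m₁ m₃ s s' : ℝ} (h0 : m₀ ∈ I) (h1 : m₁ ∈ I)
    (h3 : m₃ ∈ I) (hs : s ∈ I) (hs' : s' ∈ I) (h01 : m₀ < m₁) (h1s : m₁ < s) (hss' : s ≤ s')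
    (hs3 : s' < m₃) :
    cardyFunction (crossRatio ![g m₀, g m₁, g s, g m₃]) -
        cardyFunction (crossRatio ![g m₀, g m₁, g s', g m₃]) =
      cardyConst / 3 * |(g m₁ - g m₀) * (g m₃ - g m₀) * (g m₃ - g m₁)| ^ (1 / 3 : ℝ) *
        |∫ y in g s..g s', |(y - g m₀) * (y - g m₁) * (y - g m₃)| ^ (-(2 / 3 : ℝ))| := by
  have hω0 : ∀ (a b d : ℝ) (t : ℝ), 0 ≤ |(t - a) * (t - b) * (t - d)| ^ (-(2 / 3 : ℝ)) :=
    fun a b d t => Real.rpow_nonneg (abs_nonneg _) _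
  rcases hg with hg | hg
  · have hab : g m₀ < g m₁ := hg h0 h1 h01
    have hby : g m₁ < g s := hg h1 hs h1s
    have hyy' : g s ≤ g s' := hg.monotoneOn hs hs' hss'
    have hy'd : g s' < g m₃ := hg hs' h3 hs3
    have hbd : g m₁ < g m₃ := hby.trans (hyy'.trans_lt hy'd)
    have hpos : 0 < (g m₁ - g m₀) * (g m₃ - g m₀) * (g m₃ - g m₁) := by
      have := sub_pos.2 hab
      have := sub_pos.2 (hab.trans hbd)
      have := sub_pos.2 hbd
      positivity
    rw [kwl_cardy_sub_of_lt hab hby hyy' hy'd, abs_of_pos hpos,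
      abs_of_nonneg (intervalIntegral.integral_nonneg hyy' fun t _ => hω0 _ _ _ t)]
  · have hab : -g m₀ < -g m₁ := neg_lt_neg (hg h0 h1 h01)
    have hby : -g m₁ < -g s := neg_lt_neg (hg h1 hs h1s)
    have hyy' : -g s ≤ -g s' := neg_le_neg (hg.antitoneOn hs hs' hss')
    have hy'd : -g s' < -g m₃ := neg_lt_neg (hg hs' h3 hs3)
    have hbd : -g m₁ < -g m₃ := hby.trans (hyy'.trans_lt hy'd)
    have key := kwl_cardy_sub_of_lt hab hby hyy' hy'd
    rw [crossRatio_third_neg, crossRatio_third_neg, kwl_integral_omega_neg] at key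
    have hpos : 0 < (-g m₁ - -g m₀) * (-g m₃ - -g m₀) * (-g m₃ - -g m₁) := by
      have := sub_pos.2 hab
      have := sub_pos.2 (hab.trans hbd)
      have := sub_pos.2 hbd
      positivity
    have habs : |(g m₁ - g m₀) * (g m₃ - g m₀) * (g m₃ - g m₁)| =
        (-g m₁ - -g m₀) * (-g m₃ - -g m₀) * (-g m₃ - -g m₁) := by
      rw [show (g m₁ - g m₀) * (g m₃ - g m₀) * (g m₃ - g m₁) =
        -((-g m₁ - -g m₀) * (-g m₃ - -g m₀) * (-g m₃ - -g m₁)) by ring, abs_neg, abs_of_pos hpos]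
    have hI : ∫ y in g s..g s', |(y - g m₀) * (y - g m₁) * (y - g m₃)| ^ (-(2 / 3 : ℝ)) ≤ 0 := by
      rw [intervalIntegral.integral_symm]
      exact neg_nonpos.2 (intervalIntegral.integral_nonneg (neg_le_neg_iff.1 hyy')
        fun t _ => hω0 _ _ _ t)
    rw [key, habs, abs_of_nonpos hI]

/-- The constant `κ = (cardyConst/3) |(x₁-x₀)(x₃-x₀)(x₃-x₁)|^{1/3}` is positive for pairwise
distinct `x₀, x₁, x₃`. [folklore] -/
theorem kwl_kappa_pos {x₀ x₁ x₃ : ℝ} (h01 : x₀ ≠ x₁) (h03 : x₀ ≠ x₃) (h13 : x₁ ≠ x₃) :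
    0 < cardyConst / 3 * |(x₁ - x₀) * (x₃ - x₀) * (x₃ - x₁)| ^ (1 / 3 : ℝ) := by
  have hne : (x₁ - x₀) * (x₃ - x₀) * (x₃ - x₁) ≠ 0 :=
    mul_ne_zero (mul_ne_zero (sub_ne_zero.2 h01.symm) (sub_ne_zero.2 h03.symm))
      (sub_ne_zero.2 h13.symm)
  have := cardyConst_pos
  have := Real.rpow_pos_of_pos (abs_pos.2 hne) (1 / 3 : ℝ)
  positivity

/-! ### Change of variables along a straight side -/

/-- **Change of variables along a straight side.** Let `w` be holomorphic on an open `U`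
containing the segment `{x e + c : x ∈ [α, β]}` (`|e| = 1`, `α < β`), real-valued and injective
on it, and `G ≥ 0` continuous on the (real) image. Then
`∫_α^β |w′(xe + c)| G(Re w(xe + c)) dx = |∫_{Re w(αe+c)}^{Re w(βe+c)} G|`: the function
`H(x) = Re w(xe + c)` has derivative `Re (w′(xe+c) e)`, whose imaginary counterpart vanishes (the
imaginary part of `w` is constant on the segment), so `|w′| = |H′|`; `H` is continuous and injective,
hence strictly monotone, so `H′` has constant sign; conclude by
`intervalIntegral.integral_comp_mul_deriv'`. [folklore] -/
theorem kwl_side_integral {w : ℂ → ℂ} {U : Set ℂ} (hU : IsOpen U) (hw : DifferentiableOn ℂ w U)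
    {e c : ℂ} (he : ‖e‖ = 1) {α β : ℝ} (hαβ : α < β)
    (hPU : ∀ x ∈ Icc α β, (x : ℂ) * e + c ∈ U)
    (hreal : ∀ x ∈ Icc α β, (w ((x : ℂ) * e + c)).im = 0)
    (hinj : InjOn (fun x : ℝ => (w ((x : ℂ) * e + c)).re) (Icc α β))
    {G : ℝ → ℝ} (hG : ContinuousOn G ((fun x : ℝ => (w ((x : ℂ) * e + c)).re) '' Icc α β))
    (hG0 : ∀ y, 0 ≤ G y) :
    ∫ x in α..β, ‖deriv w ((x : ℂ) * e + c)‖ * G ((w ((x : ℂ) * e + c)).re) =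
      |∫ y in (w ((α : ℂ) * e + c)).re..(w ((β : ℂ) * e + c)).re, G y| := by
  set P : ℝ → ℂ := fun x => (x : ℂ) * e + c with hP
  set H : ℝ → ℝ := fun x => (w (P x)).re with hH
  set H' : ℝ → ℝ := fun x => (deriv w (P x) * e).re with hH'
  -- derivatives
  have hPd : ∀ x : ℝ, HasDerivAt P e x := fun x => by
    have h := ((hasDerivAt_id x).ofReal_comp.mul_const e).add_const c
    simpa [hP] using h
  have hcomp : ∀ x ∈ Icc α β, HasDerivAt (fun y : ℝ => w (P y)) (deriv w (P x) * e) x :=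
    fun x hx => ((hw.differentiableAt (hU.mem_nhds (hPU x hx))).hasDerivAt).comp x (hPd x)
  have hHd : ∀ x ∈ Icc α β, HasDerivAt H (H' x) x := fun x hx =>
    Complex.reCLM.hasFDerivAt.comp_hasDerivAt x (hcomp x hx)
  have him' : ∀ x ∈ Icc α β, (deriv w (P x) * e).im = 0 := fun x hx => by
    have h1 : HasDerivWithinAt (fun y : ℝ => (w (P y)).im) ((deriv w (P x) * e).im) (Icc α β) x :=
      (Complex.imCLM.hasFDerivAt.comp_hasDerivAt x (hcomp x hx)).hasDerivWithinAt
    have h2 : HasDerivWithinAt (fun y : ℝ => (w (P y)).im) 0 (Icc α β) x :=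
      (hasDerivWithinAt_const x (Icc α β) (0 : ℝ)).congr_of_mem (fun y hy => hreal y hy) hx
    exact (uniqueDiffOn_Icc hαβ x hx).eq_deriv _ h1 h2
  have hnorm : ∀ x ∈ Icc α β, ‖deriv w (P x)‖ = |H' x| := fun x hx => by
    have h1 : ‖deriv w (P x)‖ = ‖deriv w (P x) * e‖ := by rw [norm_mul, he, mul_one]
    have h2 : deriv w (P x) * e = (((deriv w (P x) * e).re : ℝ) : ℂ) :=
      Complex.ext (by simp) (by simp [him' x hx])
    rw [h1, h2, Complex.norm_real, Real.norm_eq_abs]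
  -- continuity
  have hHc : ContinuousOn H (Icc α β) := fun x hx => (hHd x hx).continuousAt.continuousWithinAt
  have hPc : Continuous P := by rw [hP]; fun_prop
  have hdc : ContinuousOn (fun x : ℝ => deriv w (P x)) (Icc α β) :=
    (hw.analyticOnNhd hU).deriv.continuousOn.comp hPc.continuousOn fun x hx => hPU x hx
  have hH'c : ContinuousOn H' (Icc α β) :=
    Complex.continuous_re.comp_continuousOn (hdc.mul continuousOn_const)
  -- the change of variables for `H`
  have hcv : ∫ x in α..β, (G ∘ H) x * H' x = ∫ y in H α..H β, G y := by
    refine intervalIntegral.integral_comp_mul_deriv' (fun x hx => hHd x ?_) ?_ ?_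
    · rwa [uIcc_of_le hαβ.le] at hx
    · rwa [uIcc_of_le hαβ.le]
    · rwa [uIcc_of_le hαβ.le]
  -- `H` is strictly monotone or strictly antitone; the sign of `H'`
  rcases hHc.strictMonoOn_of_injOn_Icc' hαβ.le hinj with hmono | hanti
  · have hsign : ∀ x ∈ Icc α β, 0 ≤ H' x := fun x hx =>
      HasDerivWithinAt.nonneg_of_monotoneOn (uniqueDiffOn_Icc hαβ x hx).accPt
        (hHd x hx).hasDerivWithinAt hmono.monotoneOn
    have heq : ∫ x in α..β, ‖deriv w (P x)‖ * G (H x) = ∫ x in α..β, (G ∘ H) x * H' x := by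
      refine intervalIntegral.integral_congr fun x hx => ?_
      rw [uIcc_of_le hαβ.le] at hx
      simp only [Function.comp_apply]
      rw [hnorm x hx, abs_of_nonneg (hsign x hx), mul_comm]
    have hle : H α ≤ H β := hmono.monotoneOn (left_mem_Icc.2 hαβ.le) (right_mem_Icc.2 hαβ.le) hαβ.le
    rw [heq, hcv, abs_of_nonneg (intervalIntegral.integral_nonneg hle fun y _ => hG0 y)]
  · have hsign : ∀ x ∈ Icc α β, H' x ≤ 0 := fun x hx =>
      HasDerivWithinAt.nonpos_of_antitoneOn (uniqueDiffOn_Icc hαβ x hx).accPt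
        (hHd x hx).hasDerivWithinAt hanti.antitoneOn
    have heq : ∫ x in α..β, ‖deriv w (P x)‖ * G (H x) = -∫ x in α..β, (G ∘ H) x * H' x := by
      rw [← intervalIntegral.integral_neg]
      refine intervalIntegral.integral_congr fun x hx => ?_
      rw [uIcc_of_le hαβ.le] at hx
      simp only [Function.comp_apply]
      rw [hnorm x hx, abs_of_nonpos (hsign x hx)]
      ring
    have hle : H β ≤ H α := hanti.antitoneOn (left_mem_Icc.2 hαβ.le) (right_mem_Icc.2 hαβ.le) hαβ.le
    have hI : ∫ y in H α..H β, G y ≤ 0 := by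
      rw [intervalIntegral.integral_symm]
      exact neg_nonpos.2 (intervalIntegral.integral_nonneg hle fun y _ => hG0 y)
    rw [heq, hcv, abs_of_nonpos hI]

end Summit.CriticalPhenomena.CardyFormulaZ2.Cruxes.RectilinearCardy.ExcursionKernelCovariance

end
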